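import Mathlib

/-!
# Hodge-locus census, V3-XT N = 1, wild corner ℓ = 3 — anchors for LAW K-CONG (engine A, abs-1 gen 38)

certified instances and evidence bearing on the general Hodge conjecture; no claim.

Def-free, kernel-checked finite facts behind PREREG-PARTK-A.md §K-CONG: in
𝔽₉ = 𝔽₃[w̄]/(w̄² + 1) (the residue field of ℚ(√m′) at the inert prime 3, m′ ≡ 2 (mod 3)),
elements are written as pairs `(x, y) ↔ x + y·w̄` over `ZMod 3` with the multiplication
`(x, y)·(x', y') = (x x' − y y', x y' + x' y)`.  For the residue ε̄ = −(U + V w̄) of the fundamental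
unit ε = (U + V√m′)/2:
* `sq_of_unit_coeffs_nonzero` : 3 ∤ UV ⇒ ε̄² = −UV·w̄;
* `sq_of_U_zero` / `sq_of_V_zero` : 3 ∣ U ⇒ ε̄² = −1;  3 ∣ V ⇒ ε̄² = +1 (given ε̄ ≠ 0);
* `norm_residue` : the norm residue x² + y² (= N(ε) mod 3) is −1 exactly when 3 ∤ UV and +1 when
  exactly one of U, V is ≡ 0;
* `kcong_caseform` : for every unit residue ε̄ and all h′ mod 4, h/2 mod 4, the identity
  ε̄^{2h′}·w̄^{h/2} = 1 is equivalent to the registered case form (C1)/(C2)/(C3).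
All proofs are `decide` over the finite types `ZMod 3`, `Fin 4`.
-/

set_option linter.dupNamespace false

namespace Summit.HodgeConjecture.HodgeConjecture.HodgeLocus.Census.GKKCongAnchors

/-- 3 ∤ UV: (U + V w̄)² = (U² − V²) + 2UV·w̄ = −UV·w̄ in 𝔽₉ (U² = V² = 1 in 𝔽₃). -/
theorem sq_of_unit_coeffs_nonzero :
    ∀ U V : ZMod 3, U ≠ 0 → V ≠ 0 → (U * U - V * V = 0 ∧ 2 * U * V = -(U * V)) := by decide

/-- 3 ∣ U, 3 ∤ V: (V w̄)² = −V² = −1. -/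
theorem sq_of_U_zero : ∀ V : ZMod 3, V ≠ 0 → (0 * 0 - V * V = -1 ∧ 2 * 0 * V = 0) := by decide

/-- 3 ∣ V, 3 ∤ U: U² = 1. -/
theorem sq_of_V_zero : ∀ U : ZMod 3, U ≠ 0 → (U * U - 0 * 0 = 1 ∧ 2 * U * 0 = 0) := by decide

/-- The norm form of 𝔽₉/𝔽₃ on x + y w̄ is x² + y²; it is −1 iff both coordinates are nonzero,
+1 iff exactly one is zero (and 0 iff both vanish).  Hence N(ε) = −1 ⟺ 3 ∤ UV. -/
theorem norm_residue :
    ∀ x y : ZMod 3, (x * x + y * y = -1 ↔ (x ≠ 0 ∧ y ≠ 0)) ∧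
      (x * x + y * y = 1 ↔ ((x = 0 ∧ y ≠ 0) ∨ (x ≠ 0 ∧ y = 0))) := by decide

/-- w̄ = (0, 1) has multiplicative order 4: w̄² = −1, w̄⁴ = 1 (component form). -/
theorem w_order_four :
    ((0 : ZMod 3) * 0 - 1 * 1 = -1 ∧ (0 : ZMod 3) * 1 + 1 * 0 = 0) ∧ ((-1 : ZMod 3) * (-1) = 1) := by decide

/-- K-CONG ⟺ case form.  For a unit residue e = (x, y) = ε̄ (so (x, y) ≠ (0, 0); x = −U, y = −V mod 3),
`a` = h(m′) mod 4 and `b` = h(−3m′)/2 mod 4: with `mul` the 𝔽₉ product and powers by iteration,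
ε̄^{2a}·w̄^{b} = 1  ⟺
 (3 ∣ V ∧ b = 0) ∨ (3 ∣ U ∧ 3 ∤ V ∧ b ≡ 2a (mod 4)) ∨ (3 ∤ UV ∧ b + a ≡ 2δ (mod 4)), δ = [a odd ∧ UV ≡ 1 (mod 3)].
(Exponents only matter mod 4 because ε̄² and w̄ lie in the subgroup of order 4.) -/
theorem kcong_caseform :
    ∀ x y : ZMod 3, ∀ a b : Fin 4, (x ≠ 0 ∨ y ≠ 0) →
      (let mul : ZMod 3 × ZMod 3 → ZMod 3 × ZMod 3 → ZMod 3 × ZMod 3 :=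
          fun p q => (p.1 * q.1 - p.2 * q.2, p.1 * q.2 + p.2 * q.1)
        let e2 : ZMod 3 × ZMod 3 := mul (x, y) (x, y)
        let lhs : ZMod 3 × ZMod 3 :=
          mul ((fun z => mul z e2)^[a.val] (1, 0)) ((fun z => mul z (0, 1))^[b.val] (1, 0))
        (lhs = (1, 0)) ↔
          ((y = 0 ∧ b.val = 0) ∨
           (x = 0 ∧ y ≠ 0 ∧ b.val % 4 = (2 * a.val) % 4) ∨
           (x ≠ 0 ∧ y ≠ 0 ∧
              (b.val + a.val) % 4 = (if (a.val % 2 = 1 ∧ x * y = 1) then 2 else 0)))) := by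
  decide

end Summit.HodgeConjecture.HodgeConjecture.HodgeLocus.Census.GKKCongAnchors
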